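import Summits.KontsevichZagierPeriods.KontsevichZagierPeriods.Theses.TerasomaMultiplication
import Summits.KontsevichZagierPeriods.KontsevichZagierPeriods.Theorems.MultiplicationThree.Negative.Pinned
import Summits.KontsevichZagierPeriods.KontsevichZagierPeriods.Theorems.MultiplicationThree.Negative.BolzaLever
import Literature.NumberTheory.Transcendental.KZMellinFibres
import Literature.NumberTheory.Transcendental.KZSubcalculusInvariants
import Literature.NumberTheory.Transcendental.KZDominatedFamilyRelations
import Literature.NumberTheory.Transcendental.KZLogCalculusProofs
import Literature.NumberTheory.Transcendental.KZSemialgebraicComplex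
import Mathlib.Analysis.SpecialFunctions.Pow.Deriv

/-!
# `MultiplicationThree` (stmt-KontsevichZagierPeriods-3598), line `bolza-involution-real-quotient`:
# stub S1 — auxiliary file: the involution `ι` and the shear `Ψ` as rule-(2) moves

Helper file of the stub `stub_boxToSigmaBoxAvg` of the crux `MultiplicationThree` (route
`TerasomaMultiplication`). With `u = x 0`, `v = x 1`, `Σ_box = {0 < u, 0 < v, v < 1 − u}`,
`ψ = v^{−2/3}(1−v)^{−2/3}(1−u−v)^{−1/3}`, `ψ̄ = v^{−1/3}(1−v)^{−1/3}(1−u−v)^{−2/3}`: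
* the involution `ι(u,v) = (u, (1−u−v)/(1−v))` of `Σ_box`: derivative `[[1, 0], [−1/(1−v), −u/(1−v)²]]`,
  `det Dι = −u/(1−v)²`, `ι ∘ ι = id` on `Σ_box`, `ι '' Σ_box = Σ_box`, `ℚ`-semialgebraic (rational map,
  non-vanishing denominator), and `u^{s−1}ψ̄(x) = u^{s−1}ψ(ιx)·|det Dι(x)|` exactly
  (`bolza_involution_density` of `Negative/BolzaLever.lean`), whence ONE instance `s1_involution_move`
  of Kontsevich–Zagier's rule (2): `[Σ_box, c·u^{s−1}ψ̄] − [Σ_box, c·u^{s−1}ψ] ∈ changeOfVariablesRel`;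
* the coarea shear `Ψ(v₁,v₂) = ((1−v₁)(1−v₂), v₁)` of the open box `(0,1)²` onto `Σ_box`: polynomial,
  derivative `[[−(1−v₂), −(1−v₁)], [1, 0]]`, `det DΨ = 1 − v₁`, injective, image `Σ_box`, and
  `v₁^{-2/3}(1-v₁)^{s-1}v₂^{-1/3}(1-v₂)^{s-1} = (u^{s−1}ψ)(Ψ(v))·|det DΨ(v)|` on the box, whence ONE
  instance `s1_box_shear_move` of rule (2): `[boxRep s] − [Σ_box, u^{s−1}ψ] ∈ changeOfVariablesRel`
  (`boxRep`: the pinned box representation of `Negative/Pinned.lean`).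
Pure proof file: no definitions are introduced — the maps, their derivatives (as functions of the
base point, applied at `x`) and the densities are written out, in the form in which they occur in
the side conditions of `KZ.changeOfVariablesRel`. (The standing disprover's certified §9 of
`Cruxes/MultiplicationThree/Disproof.lean`.)
References: M. Kontsevich, D. Zagier, *Periods* (2001), §1.2 rule (2).
-/

noncomputable section

open Set MeasureTheory MvPolynomial Real
open scoped BigOperators
open Literature.NumberTheory.Transcendental Literature.NumberTheory.Transcendental.KZ
open Literature.ModelTheory.ExponentialFields (IsSemialgebraic)

namespace Summit.KontsevichZagierPeriods.TerasomaMultiplication.MultiplicationThreeBolza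

open Summit.KontsevichZagierPeriods.TerasomaMultiplication.MultiplicationThreeNegative

/-! ### The sheared box `Σ_box` and its involution `ι` -/

/-- `Σ_box` is `ℚ`-semialgebraic (positivity set of `X 0`, `X 1`, `1 − X 0 − X 1`). [folklore] -/
theorem s1_isSemialgebraic_sigmaBox :
    IsSemialgebraic ℚ {x : Fin 2 → ℝ | 0 < x 0 ∧ 0 < x 1 ∧ x 1 < 1 - x 0} := by
  have h : {x : Fin 2 → ℝ | 0 < x 0 ∧ 0 < x 1 ∧ x 1 < 1 - x 0} = {x | ∀ l, 0 < aeval x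
      ((![X 0, X 1, 1 - X 0 - X 1] : Fin 3 → MvPolynomial (Fin 2) ℚ) l)} := by
    ext x
    simp only [mem_setOf_eq, Fin.forall_fin_succ, Matrix.cons_val_zero, Matrix.cons_val_succ,
      map_sub, map_one, MvPolynomial.aeval_X]
    constructor
    · rintro ⟨h0, h1, h2⟩; exact ⟨h0, h1, by linarith, fun i => Fin.elim0 i⟩
    · rintro ⟨h0, h1, h2, -⟩; exact ⟨h0, h1, by linarith⟩
  rw [h]; exact isSemialgebraic_setOf_forall_aeval_pos _

/-- The derivative of `ι` (at `x`) applied to a vector `v`. [folklore] -/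
theorem s1_iotaD_apply (x v : Fin 2 → ℝ) :
    (fun x : Fin 2 → ℝ => LinearMap.toContinuousLinearMap
      (Matrix.toLin' !![(1:ℝ), 0; -1 / (1 - x 1), -(x 0) / (1 - x 1) ^ 2])) x v =
      ![v 0, -1 / (1 - x 1) * v 0 + -(x 0) / (1 - x 1) ^ 2 * v 1] := by
  change Matrix.toLin' _ v = _
  rw [Matrix.toLin'_apply]
  funext i
  fin_cases i <;> simp [Matrix.mulVec, dotProduct, Fin.sum_univ_two]

/-- `det Dι(u,v) = −u/(1−v)²`. [folklore] -/
theorem s1_det_iotaD (x : Fin 2 → ℝ) :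
    ((fun x : Fin 2 → ℝ => LinearMap.toContinuousLinearMap
      (Matrix.toLin' !![(1:ℝ), 0; -1 / (1 - x 1), -(x 0) / (1 - x 1) ^ 2])) x).det =
      -(x 0) / (1 - x 1) ^ 2 := by
  change LinearMap.det (Matrix.toLin'
    (!![(1:ℝ), 0; -1 / (1 - x 1), -(x 0) / (1 - x 1) ^ 2] : Matrix (Fin 2) (Fin 2) ℝ)) = _
  rw [LinearMap.det_toLin', Matrix.det_fin_two]
  simp

/-- `ι` is differentiable off `v = 1`, with derivative `Dι`. [folklore] -/
theorem s1_hasFDerivAt_iota {x : Fin 2 → ℝ} (hx : x 1 ≠ 1) :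
    HasFDerivAt (fun x : Fin 2 → ℝ => (![x 0, (1 - x 0 - x 1) / (1 - x 1)] : Fin 2 → ℝ))
      ((fun x : Fin 2 → ℝ => LinearMap.toContinuousLinearMap
        (Matrix.toLin' !![(1:ℝ), 0; -1 / (1 - x 1), -(x 0) / (1 - x 1) ^ 2])) x) x := by
  have h1x : 1 - x 1 ≠ 0 := sub_ne_zero.mpr (Ne.symm hx)
  have h0 : HasFDerivAt (fun y : Fin 2 → ℝ => y 0)
      (ContinuousLinearMap.proj (R := ℝ) (φ := fun _ : Fin 2 => ℝ) 0) x :=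
    hasFDerivAt_apply 0 x
  have h1 : HasFDerivAt (fun y : Fin 2 → ℝ => y 1)
      (ContinuousLinearMap.proj (R := ℝ) (φ := fun _ : Fin 2 => ℝ) 1) x :=
    hasFDerivAt_apply 1 x
  rw [hasFDerivAt_pi']
  refine Fin.forall_fin_two.mpr ⟨?_, ?_⟩
  · have hf : (fun y : Fin 2 → ℝ =>
        (fun x : Fin 2 → ℝ => (![x 0, (1 - x 0 - x 1) / (1 - x 1)] : Fin 2 → ℝ)) y 0) =
        fun y => y 0 := funext fun y => rfl
    rw [hf]
    refine h0.congr_fderiv (ContinuousLinearMap.ext fun v => ?_)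
    rw [ContinuousLinearMap.comp_apply, s1_iotaD_apply]
    simp
  · have hf : (fun y : Fin 2 → ℝ =>
        (fun x : Fin 2 → ℝ => (![x 0, (1 - x 0 - x 1) / (1 - x 1)] : Fin 2 → ℝ)) y 1) =
        fun y => (1 - y 0 - y 1) * (1 - y 1)⁻¹ :=
      funext fun y => by simp [div_eq_mul_inv]
    rw [hf]
    have hnum : HasFDerivAt (fun y : Fin 2 → ℝ => 1 - y 0 - y 1)
        (-(ContinuousLinearMap.proj (R := ℝ) (φ := fun _ : Fin 2 => ℝ) 0) -
          ContinuousLinearMap.proj (R := ℝ) (φ := fun _ : Fin 2 => ℝ) 1) x :=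
      (h0.const_sub 1).sub h1
    have hden : HasFDerivAt (fun y : Fin 2 → ℝ => (1 - y 1)⁻¹)
        ((ContinuousLinearMap.smulRight (1 : ℝ →L[ℝ] ℝ) (-((1 - x 1) ^ 2)⁻¹)).comp
          (-(ContinuousLinearMap.proj (R := ℝ) (φ := fun _ : Fin 2 => ℝ) 1))) x :=
      (hasFDerivAt_inv h1x).comp x (h1.const_sub 1)
    refine (hnum.mul hden).congr_fderiv (ContinuousLinearMap.ext fun v => ?_)
    rw [ContinuousLinearMap.comp_apply, s1_iotaD_apply]
    simp
    field_simp
    ring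

/-- `ι` is an involution of `Σ_box`. [folklore] -/
theorem s1_iota_iota {x : Fin 2 → ℝ} (hx : x ∈ {x : Fin 2 → ℝ | 0 < x 0 ∧ 0 < x 1 ∧ x 1 < 1 - x 0}) :
    (fun x : Fin 2 → ℝ => (![x 0, (1 - x 0 - x 1) / (1 - x 1)] : Fin 2 → ℝ))
      ((fun x : Fin 2 → ℝ => (![x 0, (1 - x 0 - x 1) / (1 - x 1)] : Fin 2 → ℝ)) x) = x := by
  obtain ⟨h0, h1, h2⟩ := hx
  have h1x : 1 - x 1 ≠ 0 := by linarith
  funext i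
  fin_cases i
  · rfl
  · change (1 - x 0 - (1 - x 0 - x 1) / (1 - x 1)) / (1 - (1 - x 0 - x 1) / (1 - x 1)) = x 1
    have hu : (1 - (1 - x 0 - x 1) / (1 - x 1)) = x 0 / (1 - x 1) := by field_simp; ring
    rw [hu]; field_simp; ring

/-- `ι` is injective on `Σ_box`. [folklore] -/
theorem s1_injOn_iota :
    InjOn (fun x : Fin 2 → ℝ => (![x 0, (1 - x 0 - x 1) / (1 - x 1)] : Fin 2 → ℝ))
      {x : Fin 2 → ℝ | 0 < x 0 ∧ 0 < x 1 ∧ x 1 < 1 - x 0} := fun _ hx _ hy hxy =>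
  ((s1_iota_iota hx).symm.trans (congrArg
    (fun x : Fin 2 → ℝ => (![x 0, (1 - x 0 - x 1) / (1 - x 1)] : Fin 2 → ℝ)) hxy)).trans
    (s1_iota_iota hy)

/-- `ι` maps `Σ_box` ONTO itself. [folklore] -/
theorem s1_image_iota :
    (fun x : Fin 2 → ℝ => (![x 0, (1 - x 0 - x 1) / (1 - x 1)] : Fin 2 → ℝ)) ''
        {x : Fin 2 → ℝ | 0 < x 0 ∧ 0 < x 1 ∧ x 1 < 1 - x 0} =
      {x : Fin 2 → ℝ | 0 < x 0 ∧ 0 < x 1 ∧ x 1 < 1 - x 0} := by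
  have hmaps : MapsTo (fun x : Fin 2 → ℝ => (![x 0, (1 - x 0 - x 1) / (1 - x 1)] : Fin 2 → ℝ))
      {x : Fin 2 → ℝ | 0 < x 0 ∧ 0 < x 1 ∧ x 1 < 1 - x 0}
      {x : Fin 2 → ℝ | 0 < x 0 ∧ 0 < x 1 ∧ x 1 < 1 - x 0} := by
    intro x hx
    obtain ⟨h0, h1, h2⟩ := hx
    have h1x : 0 < 1 - x 1 := by linarith
    refine ⟨h0, ?_, ?_⟩
    · change 0 < (1 - x 0 - x 1) / (1 - x 1)
      exact div_pos (by linarith) h1x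
    · change (1 - x 0 - x 1) / (1 - x 1) < 1 - x 0
      rw [div_lt_iff₀ h1x]
      nlinarith
  exact (hmaps.image_subset).antisymm fun y hy =>
    ⟨(fun x : Fin 2 → ℝ => (![x 0, (1 - x 0 - x 1) / (1 - x 1)] : Fin 2 → ℝ)) y,
      hmaps hy, s1_iota_iota hy⟩

/-- `ι` is a `ℚ`-semialgebraic map on `Σ_box` (a rational map with non-vanishing denominator).
[folklore] -/
theorem s1_isSemialgebraicMapOn_iota :
    IsSemialgebraicMapOn ℚ {x : Fin 2 → ℝ | 0 < x 0 ∧ 0 < x 1 ∧ x 1 < 1 - x 0}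
      (fun x : Fin 2 → ℝ => (![x 0, (1 - x 0 - x 1) / (1 - x 1)] : Fin 2 → ℝ)) := by
  refine IsSemialgebraicMapOn.of_forall s1_isSemialgebraic_sigmaBox
    (Fin.forall_fin_two.mpr ⟨?_, ?_⟩)
  · exact (isSemialgebraicFunOn_aeval s1_isSemialgebraic_sigmaBox (X 0)).congr fun x _ => by simp
  · have hn := isSemialgebraicFunOn_aeval s1_isSemialgebraic_sigmaBox
      (1 - X 0 - X 1 : MvPolynomial (Fin 2) ℚ)
    have hd := isSemialgebraicFunOn_aeval s1_isSemialgebraic_sigmaBox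
      (1 - X 1 : MvPolynomial (Fin 2) ℚ)
    refine (hn.div hd fun x hx => ?_).congr fun x _ => ?_
    · simp only [map_sub, map_one, MvPolynomial.aeval_X]
      obtain ⟨h0, -, h2⟩ := hx
      linarith
    · simp

/-- The rule-(2) integrand relation of the involution: `u^{s−1}ψ̄ = (u^{s−1}ψ) ∘ ι · |det Dι|` on
`Σ_box` (the exact identity `bolza_involution_density`). [folklore] -/
theorem s1_psiBar_eq_jacobian {s : ℚ} {x : Fin 2 → ℝ}
    (hx : x ∈ {x : Fin 2 → ℝ | 0 < x 0 ∧ 0 < x 1 ∧ x 1 < 1 - x 0}) :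
    (fun x : Fin 2 → ℝ => x 0 ^ ((s:ℝ) - 1) *
        (x 1 ^ (-(1:ℝ)/3) * (1 - x 1) ^ (-(1:ℝ)/3) * (1 - x 0 - x 1) ^ (-(2:ℝ)/3))) x =
      (fun x : Fin 2 → ℝ => x 0 ^ ((s:ℝ) - 1) *
          (x 1 ^ (-(2:ℝ)/3) * (1 - x 1) ^ (-(2:ℝ)/3) * (1 - x 0 - x 1) ^ (-(1:ℝ)/3)))
        ((fun x : Fin 2 → ℝ => (![x 0, (1 - x 0 - x 1) / (1 - x 1)] : Fin 2 → ℝ)) x) *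
      |((fun x : Fin 2 → ℝ => LinearMap.toContinuousLinearMap
          (Matrix.toLin' !![(1:ℝ), 0; -1 / (1 - x 1), -(x 0) / (1 - x 1) ^ 2])) x).det| := by
  obtain ⟨h0, h1, h2⟩ := hx
  have h1x : 0 < 1 - x 1 := by linarith
  have habs : |((fun x : Fin 2 → ℝ => LinearMap.toContinuousLinearMap
      (Matrix.toLin' !![(1:ℝ), 0; -1 / (1 - x 1), -(x 0) / (1 - x 1) ^ 2])) x).det| =
      x 0 / (1 - x 1) ^ 2 := by
    rw [s1_det_iotaD, neg_div, abs_neg, abs_of_pos (div_pos h0 (by positivity))]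
  rw [habs]
  simp only [Matrix.cons_val_zero, Matrix.cons_val_one]
  have h1ι : 1 - (1 - x 0 - x 1) / (1 - x 1) = x 0 / (1 - x 1) := by field_simp; ring
  have h1uι : 1 - x 0 - (1 - x 0 - x 1) / (1 - x 1) = x 0 * x 1 / (1 - x 1) := by field_simp; ring
  rw [h1ι, h1uι, ← bolza_involution_density h0 h1 h2]
  ring

/-- **Move (i) of the bolza chain is ONE rule-(2) instance**: for representations `R`, `R'` on
`Σ_box` with integrands `c·u^{s−1}ψ̄` resp. `c·u^{s−1}ψ`, `[R] − [R'] ∈ changeOfVariablesRel` along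
the involution `ι`. [cite: KontsevichZagier2001, §1.2 rule (2)] [folklore] -/
theorem s1_involution_move {s : ℚ} (c : ℝ) (R R' : IntegralRep 2)
    (hR : R.domain = {x : Fin 2 → ℝ | 0 < x 0 ∧ 0 < x 1 ∧ x 1 < 1 - x 0})
    (hRi : EqOn R.integrand (fun x => c * (fun x : Fin 2 → ℝ => x 0 ^ ((s:ℝ) - 1) *
      (x 1 ^ (-(1:ℝ)/3) * (1 - x 1) ^ (-(1:ℝ)/3) * (1 - x 0 - x 1) ^ (-(2:ℝ)/3))) x) R.domain)
    (hR' : R'.domain = {x : Fin 2 → ℝ | 0 < x 0 ∧ 0 < x 1 ∧ x 1 < 1 - x 0})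
    (hR'i : EqOn R'.integrand (fun x => c * (fun x : Fin 2 → ℝ => x 0 ^ ((s:ℝ) - 1) *
      (x 1 ^ (-(2:ℝ)/3) * (1 - x 1) ^ (-(2:ℝ)/3) * (1 - x 0 - x 1) ^ (-(1:ℝ)/3))) x) R'.domain) :
    of R - of R' ∈ changeOfVariablesRel := by
  refine ⟨2, R, R', (fun x : Fin 2 → ℝ => (![x 0, (1 - x 0 - x 1) / (1 - x 1)] : Fin 2 → ℝ)),
    (fun x : Fin 2 → ℝ => LinearMap.toContinuousLinearMap
      (Matrix.toLin' !![(1:ℝ), 0; -1 / (1 - x 1), -(x 0) / (1 - x 1) ^ 2])),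
    ?_, fun x hx => ?_, ?_, ?_, fun x hx => ?_, rfl⟩
  · rw [hR]; exact s1_isSemialgebraicMapOn_iota
  · rw [hR] at hx
    have : x 1 ≠ 1 := by obtain ⟨h0, -, h2⟩ := hx; linarith
    exact (s1_hasFDerivAt_iota this).hasFDerivWithinAt
  · rw [hR]; exact s1_injOn_iota
  · rw [hR', hR, s1_image_iota]
  · have hx' : x ∈ {x : Fin 2 → ℝ | 0 < x 0 ∧ 0 < x 1 ∧ x 1 < 1 - x 0} := hR ▸ hx
    have e1 : R.integrand x = c * (fun x : Fin 2 → ℝ => x 0 ^ ((s:ℝ) - 1) *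
        (x 1 ^ (-(1:ℝ)/3) * (1 - x 1) ^ (-(1:ℝ)/3) * (1 - x 0 - x 1) ^ (-(2:ℝ)/3))) x := hRi hx
    have e2 : R'.integrand
        ((fun x : Fin 2 → ℝ => (![x 0, (1 - x 0 - x 1) / (1 - x 1)] : Fin 2 → ℝ)) x) =
        c * (fun x : Fin 2 → ℝ => x 0 ^ ((s:ℝ) - 1) *
          (x 1 ^ (-(2:ℝ)/3) * (1 - x 1) ^ (-(2:ℝ)/3) * (1 - x 0 - x 1) ^ (-(1:ℝ)/3)))
          ((fun x : Fin 2 → ℝ => (![x 0, (1 - x 0 - x 1) / (1 - x 1)] : Fin 2 → ℝ)) x) :=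
      hR'i (by rw [hR', ← s1_image_iota]; exact ⟨x, hx', rfl⟩)
    rw [e1, e2, s1_psiBar_eq_jacobian hx']
    ring

/-! ### Move 0: the coarea shear `Ψ(v₁,v₂) = ((1−v₁)(1−v₂), v₁)` of the box onto `Σ_box` -/

/-- The derivative of the shear (at `x`) applied to a vector `v`. [folklore] -/
theorem s1_shearD_apply (x v : Fin 2 → ℝ) :
    (fun x : Fin 2 → ℝ => LinearMap.toContinuousLinearMap
      (Matrix.toLin' !![-(1 - x 1), -(1 - x 0); (1:ℝ), 0])) x v =
      ![-(1 - x 1) * v 0 + -(1 - x 0) * v 1, v 0] := by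
  change Matrix.toLin' _ v = _
  rw [Matrix.toLin'_apply]
  funext i
  fin_cases i <;> simp [Matrix.mulVec, dotProduct, Fin.sum_univ_two]

/-- `det DΨ(v₁,v₂) = 1 − v₁`. [folklore] -/
theorem s1_det_shearD (x : Fin 2 → ℝ) :
    ((fun x : Fin 2 → ℝ => LinearMap.toContinuousLinearMap
      (Matrix.toLin' !![-(1 - x 1), -(1 - x 0); (1:ℝ), 0])) x).det = 1 - x 0 := by
  change LinearMap.det (Matrix.toLin'
    (!![-(1 - x 1), -(1 - x 0); (1:ℝ), 0] : Matrix (Fin 2) (Fin 2) ℝ)) = _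
  rw [LinearMap.det_toLin', Matrix.det_fin_two]
  simp

/-- The shear is differentiable, with derivative `DΨ`. [folklore] -/
theorem s1_hasFDerivAt_shear (x : Fin 2 → ℝ) :
    HasFDerivAt (fun x : Fin 2 → ℝ => (![(1 - x 0) * (1 - x 1), x 0] : Fin 2 → ℝ))
      ((fun x : Fin 2 → ℝ => LinearMap.toContinuousLinearMap
        (Matrix.toLin' !![-(1 - x 1), -(1 - x 0); (1:ℝ), 0])) x) x := by
  have h0 : HasFDerivAt (fun y : Fin 2 → ℝ => y 0)
      (ContinuousLinearMap.proj (R := ℝ) (φ := fun _ : Fin 2 => ℝ) 0) x :=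
    hasFDerivAt_apply 0 x
  have h1 : HasFDerivAt (fun y : Fin 2 → ℝ => y 1)
      (ContinuousLinearMap.proj (R := ℝ) (φ := fun _ : Fin 2 => ℝ) 1) x :=
    hasFDerivAt_apply 1 x
  rw [hasFDerivAt_pi']
  refine Fin.forall_fin_two.mpr ⟨?_, ?_⟩
  · have hf : (fun y : Fin 2 → ℝ =>
        (fun x : Fin 2 → ℝ => (![(1 - x 0) * (1 - x 1), x 0] : Fin 2 → ℝ)) y 0) =
        fun y => (1 - y 0) * (1 - y 1) := funext fun y => rfl
    rw [hf]
    refine ((h0.const_sub 1).mul (h1.const_sub 1)).congr_fderiv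
      (ContinuousLinearMap.ext fun v => ?_)
    rw [ContinuousLinearMap.comp_apply, s1_shearD_apply]
    simp
    ring
  · have hf : (fun y : Fin 2 → ℝ =>
        (fun x : Fin 2 → ℝ => (![(1 - x 0) * (1 - x 1), x 0] : Fin 2 → ℝ)) y 1) =
        fun y => y 0 := funext fun y => rfl
    rw [hf]
    refine h0.congr_fderiv (ContinuousLinearMap.ext fun v => ?_)
    rw [ContinuousLinearMap.comp_apply, s1_shearD_apply]
    simp

/-- The shear is injective on the box. [folklore] -/
theorem s1_injOn_shear :
    InjOn (fun x : Fin 2 → ℝ => (![(1 - x 0) * (1 - x 1), x 0] : Fin 2 → ℝ)) box := by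
  intro x hx y hy hxy
  have h1 : x 0 = y 0 := by simpa using congrFun hxy 1
  have h0 : x 1 = y 1 := by
    have := congrFun hxy 0
    simp only [Matrix.cons_val_zero, h1] at this
    have hne : (1 - y 0) ≠ 0 := by have := (hy 0).2; linarith
    have := mul_left_cancel₀ hne this
    linarith
  funext i
  fin_cases i; exacts [h1, h0]

/-- The shear maps the box ONTO `Σ_box`. [folklore] -/
theorem s1_image_shear_box :
    (fun x : Fin 2 → ℝ => (![(1 - x 0) * (1 - x 1), x 0] : Fin 2 → ℝ)) '' box =
      {x : Fin 2 → ℝ | 0 < x 0 ∧ 0 < x 1 ∧ x 1 < 1 - x 0} := by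
  ext y
  constructor
  · rintro ⟨x, hx, rfl⟩
    have h0 := hx 0
    have h1 := hx 1
    refine ⟨mul_pos (by linarith [h0.2]) (by linarith [h1.2]), by simpa using h0.1, ?_⟩
    simp only [Matrix.cons_val_zero, Matrix.cons_val_one]
    nlinarith [h0.1, h0.2, h1.1, h1.2, mul_pos (sub_pos.2 h0.2) h1.1]
  · rintro ⟨hy0, hy1, hy2⟩
    have h1 : 0 < 1 - y 1 := by linarith
    refine ⟨![y 1, 1 - y 0 / (1 - y 1)], Fin.forall_fin_two.mpr ⟨?_, ?_⟩, ?_⟩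
    · change y 1 ∈ Ioo (0:ℝ) 1
      exact ⟨hy1, by linarith⟩
    · change 1 - y 0 / (1 - y 1) ∈ Ioo (0:ℝ) 1
      refine ⟨?_, by have := div_pos hy0 h1; linarith⟩
      rw [sub_pos, div_lt_one h1]; linarith
    · funext i
      fin_cases i
      · change (1 - y 1) * (1 - (1 - y 0 / (1 - y 1))) = y 0
        field_simp; ring
      · rfl

/-- The shear is a `ℚ`-semialgebraic map (polynomial). [folklore] -/
theorem s1_isSemialgebraicMapOn_shear :
    IsSemialgebraicMapOn ℚ box
      (fun x : Fin 2 → ℝ => (![(1 - x 0) * (1 - x 1), x 0] : Fin 2 → ℝ)) :=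
  (isSemialgebraicMapOn_aeval isSemialgebraic_box
    (![(1 - X 0) * (1 - X 1), X 0] : Fin 2 → MvPolynomial (Fin 2) ℚ)).congr fun x _ => by
    funext i
    fin_cases i <;> simp

/-- The rule-(2) integrand relation of the shear: `boxFun = (u^{s−1}ψ) ∘ Ψ · |det DΨ|` on the box.
[folklore] -/
theorem s1_boxFun_eq_shear_jacobian {s : ℚ} {x : Fin 2 → ℝ} (hx : x ∈ box) :
    boxFun s x =
      (fun x : Fin 2 → ℝ => x 0 ^ ((s:ℝ) - 1) *
          (x 1 ^ (-(2:ℝ)/3) * (1 - x 1) ^ (-(2:ℝ)/3) * (1 - x 0 - x 1) ^ (-(1:ℝ)/3)))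
        ((fun x : Fin 2 → ℝ => (![(1 - x 0) * (1 - x 1), x 0] : Fin 2 → ℝ)) x) *
      |((fun x : Fin 2 → ℝ => LinearMap.toContinuousLinearMap
          (Matrix.toLin' !![-(1 - x 1), -(1 - x 0); (1:ℝ), 0])) x).det| := by
  have h0 := hx 0; have h1 := hx 1
  have hu : 0 < 1 - x 0 := sub_pos.2 h0.2; have hv : 0 < 1 - x 1 := sub_pos.2 h1.2
  rw [s1_det_shearD, abs_of_pos hu]
  simp only [boxFun, Matrix.cons_val_zero, Matrix.cons_val_one]
  have hN : 1 - (1 - x 0) * (1 - x 1) - x 0 = (1 - x 0) * x 1 := by ring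
  rw [hN, mul_rpow hu.le hv.le, mul_rpow hu.le h1.1.le]
  -- collect the powers of (1 - x 0): (s-1) + (-2/3) + (-1/3) + 1 = s - 1
  have hA : (1 - x 0) ^ ((s:ℝ) - 1) * (1 - x 0) ^ (-(2:ℝ)/3) * (1 - x 0) ^ (-(1:ℝ)/3) * (1 - x 0) =
      (1 - x 0) ^ ((s:ℝ) - 1) := by
    rw [← rpow_add hu, ← rpow_add hu, ← rpow_add_one hu.ne']
    congr 1
    ring
  calc x 0 ^ (-(2:ℝ)/3) * (1 - x 0) ^ ((s:ℝ) - 1) * x 1 ^ (-(1:ℝ)/3) * (1 - x 1) ^ ((s:ℝ) - 1)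
      = x 0 ^ (-(2:ℝ)/3) * x 1 ^ (-(1:ℝ)/3) * (1 - x 1) ^ ((s:ℝ) - 1) *
          ((1 - x 0) ^ ((s:ℝ) - 1) * (1 - x 0) ^ (-(2:ℝ)/3) * (1 - x 0) ^ (-(1:ℝ)/3) *
            (1 - x 0)) := by rw [hA]; ring
    _ = _ := by ring

/-- **Move 0 of the bolza chain is ONE rule-(2) instance**: the pinned box representation minus any
representation of `u^{s−1}ψ` on `Σ_box` lies in `changeOfVariablesRel` (the coarea shear).
[cite: KontsevichZagier2001, §1.2 rule (2)] [folklore] -/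
theorem s1_box_shear_move {s : ℚ} (hs : 0 < s) (R' : IntegralRep 2)
    (hR' : R'.domain = {x : Fin 2 → ℝ | 0 < x 0 ∧ 0 < x 1 ∧ x 1 < 1 - x 0})
    (hR'i : EqOn R'.integrand (fun x : Fin 2 → ℝ => x 0 ^ ((s:ℝ) - 1) *
      (x 1 ^ (-(2:ℝ)/3) * (1 - x 1) ^ (-(2:ℝ)/3) * (1 - x 0 - x 1) ^ (-(1:ℝ)/3))) R'.domain) :
    of (boxRep s hs) - of R' ∈ changeOfVariablesRel := by
  refine ⟨2, boxRep s hs, R',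
    (fun x : Fin 2 → ℝ => (![(1 - x 0) * (1 - x 1), x 0] : Fin 2 → ℝ)),
    (fun x : Fin 2 → ℝ => LinearMap.toContinuousLinearMap
      (Matrix.toLin' !![-(1 - x 1), -(1 - x 0); (1:ℝ), 0])),
    s1_isSemialgebraicMapOn_shear, fun x _ => (s1_hasFDerivAt_shear x).hasFDerivWithinAt,
    s1_injOn_shear, ?_, fun x hx => ?_, rfl⟩
  · rw [hR']; exact s1_image_shear_box.symm
  · have hx' : x ∈ box := hx
    change boxFun s x = _
    rw [s1_boxFun_eq_shear_jacobian hx',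
      hR'i (by rw [hR', ← s1_image_shear_box]; exact ⟨x, hx', rfl⟩)]

/-- **Registered sub-goal of this auxiliary file**: move 0 (the coarea shear) as ONE instance of
Kontsevich–Zagier's rule (2), the closed form of `s1_box_shear_move`.
[cite: KontsevichZagier2001, §1.2 rule (2)] [folklore] -/
theorem stub_boxToSigmaBoxAvg_shearMove :
    ∀ (s : ℚ) (hs : 0 < s) (R' : Literature.NumberTheory.Transcendental.KZ.IntegralRep 2), R'.domain = {x : Fin 2 → ℝ | 0 < x 0 ∧ 0 < x 1 ∧ x 1 < 1 - x 0} → Set.EqOn R'.integrand (fun x : Fin 2 → ℝ => x 0 ^ ((s:ℝ) - 1) * (x 1 ^ (-(2:ℝ)/3) * (1 - x 1) ^ (-(2:ℝ)/3) * (1 - x 0 - x 1) ^ (-(1:ℝ)/3))) R'.domain → Literature.NumberTheory.Transcendental.KZ.of (Summit.KontsevichZagierPeriods.TerasomaMultiplication.MultiplicationThreeNegative.boxRep s hs) - Literature.NumberTheory.Transcendental.KZ.of R' ∈ Literature.NumberTheory.Transcendental.KZ.changeOfVariablesRel :=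
  fun _ hs R' hR' hR'i => s1_box_shear_move hs R' hR' hR'i

end Summit.KontsevichZagierPeriods.TerasomaMultiplication.MultiplicationThreeBolza

end
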